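import Summits.QuantumFields.YangMills.Theorems.SmallFieldWideningLargeFieldMassRefinementTailOfFirstExit
import Literature.MathematicalPhysics.QuantumFieldTheory.Balaban1983to89.T3NestedUnitLaws
import Literature.MathematicalPhysics.QuantumFieldTheory.Balaban1983to89.T3FinestHeightTail
import Literature.MathematicalPhysics.QuantumFieldTheory.Balaban1983to89.TorusGeometry
import HarnessLib

/-!
# Crux `FluctuationComparisonRegPrIntL` (stmt-QuantumFields-20520), LINE «run-pair organ» (ym-r3-idea-1, skeleton v8) — stub S1b
# `RunWindowTails`, part 1/2: THE RUN-WINDOW-TAILS ENGINE (nested-law transport, explicit height profile, floor-class weights)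

S1b (`stub_runWindowTails`, also stub T of `Lines/fixed_height_floor.lean`) asks, per profile, for a floor-class tails profile `η` bounding the
window complements `ν^K_j{¬PlaqSmall θ(j)}` of ALL nested cut-off laws of a run, uniformly in the cut-off `K`; its card sizes it «M given
26243» (the first-exit window tail of route `FirstExitWindow`).  This file is the engine of that derivation, one family and one coupling at a time:
§1 the window event of the nested law `ν^K_j` IS the `Gibbs_K`-event «`Ū^{K−j}` not `θ(j)`-small» (`T3NestedUnitLaws.iter_descend` +
`T3CruxEstimates.plaqSmall_fieldShift`, downward induction on the height); §2 the least-bad-height decomposition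
(`HistoryTailOfTwoSided.real_compl_histGood_le_sum_finestBad`) bounds that event by the TAIL `Σ_{h ≥ j} f(h)` of any height profile `f`
dominating the bare level and the finest bad levels; §3 the explicit profile `f(h) = 9(8L^{3m}L^{3h})·C·β_h^A·e^{−c p(g_h)²}` dominates
both (bare: `T3FinestHeightTail.gibbsK_real_not_plaqSmall_le`; finest bad levels: the window + the first-exit tail through
`LargeFieldMassRefinementTailOfFirstExit.real_finestBad_le_card_mul`); §4 the floor-class weight `(1 + 2β_h#Plaq_h)#PBond_h² ≤ 145·72²L^{9m}β_h^{10}`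
and the geometric majorant of the weighted profile (`T3AveragedTailProfile.perHeight_bound`).  Part 2/2 (`…RunWindowTailsOfFirstExit.lean`)
sums the tails and states the door.  QUANTIFIER NOTE: the derivation is PER BLOCK SIZE `L` (`γ₁ = γ₁(L, b₀, p₀)`), the form in which 26243 and
every neighbouring R3 crux are typed; the skeleton's S1b (v5–v8) asks `γ₁` uniform in the family, which 26243 cannot deliver — see part 2.

Width seat `ym-line-sfw-p2-w3` g32 (cell `ym-idea-1`, R3 family; free hands).  HONEST FRAMING: bookkeeping over landed tree estimates; the
first-exit tail 26243 (organ-class, XL) is NOT proved; no crux, rung or summit is proved; `YM3TorusSU2` and the Yang–Mills mass gap are NOT proved.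
-/

noncomputable section

set_option autoImplicit false

open MeasureTheory Filter Topology
open Literature.MathematicalPhysics.QuantumFieldTheory.Balaban1983to89
open Literature.MathematicalPhysics.QuantumFieldTheory.Balaban1983to89.T3ContinuumYM3Torus
open Literature.MathematicalPhysics.QuantumFieldTheory.Balaban1983to89.T3NestedUnitLaws
open Literature.MathematicalPhysics.QuantumFieldTheory.Balaban1983to89.T3UnitScaleTilt
open Literature.MathematicalPhysics.QuantumFieldTheory.Balaban1983to89.T3UnitLawDensityEML (ℰp measurableE_ℰp)
open Summit.QuantumFields.YangMills.Theorems.HistoryTailOfTwoSided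
open Summit.QuantumFields.YangMills.Theorems.LargeFieldMassRefinementTailOfFirstExit

namespace Summit.QuantumFields.YangMills.Theorems.FluctuationComparisonRegPrIntL.RunPairOrgan.RunWindowTailsDoor

variable (F : T3Family)

/-! ## §1 Window events of the nested cut-off laws are Gibbs events of the block-averaged fields -/

/-- The «`k`-fold (0.4)-average is not `θ`-small» event on the fine fields of the `i`-th approximation. [cite: Balaban1985UV3, (7) p.257] -/
def badAvg (θ : ℝ) (i k : ℕ) : Set (GaugeField (F.P i) 0 (Matrix.specialUnitaryGroup (Fin 2) ℂ)) :=
  {U | ¬ PlaqSmall θ (Averaging.iter (fun i' => BlockAveraging.blockAvg (P := F.P i) (j := i') ℰp) k U)}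

/-- `badAvg` is measurable (`measurable_iter`, `measurableSet_plaqSmall`). [folklore] -/
theorem measurableSet_badAvg (θ : ℝ) (i k : ℕ) : MeasurableSet (badAvg F θ i k) :=
  (T4Continuum.measurable_iter _ (F.avgMeasurable_of_measurableE ℰp measurableE_ℰp i) k (measurableSet_plaqSmall θ)).compl

/-- One descent shifts the averaging count: `descend ⁻¹' badAvg i k = badAvg (i+1) (k+1)` (level homogeneity (0.11) of
[Balaban1987RG1], tree `iter_descend`, and invariance of `PlaqSmall` under the re-indexing `fieldShift`). [cite: Balaban1987RG1, (0.11) p.253] -/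
theorem preimage_descend_badAvg (θ : ℝ) (i k : ℕ) :
    (descend F ℰp i) ⁻¹' (badAvg F θ i k) = badAvg F θ (i + 1) (k + 1) := by
  ext U
  simp only [badAvg, Set.mem_preimage, Set.mem_setOf_eq]
  have h := iter_descend F ℰp i k U
  have h' : PlaqSmall θ (Averaging.iter (fun i' => BlockAveraging.blockAvg (P := F.P i) (j := i') ℰp) k (descend F ℰp i U)) ↔
      PlaqSmall θ (Averaging.iter (fun i' => BlockAveraging.blockAvg (P := F.P (i + 1)) (j := i') ℰp) (k + 1) U) := by
    have hs := T3CruxEstimates.plaqSmall_fieldShift F (sitesPerDir_descend F i k) θ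
      (Averaging.iter (fun i' => BlockAveraging.blockAvg (P := F.PP F.m (i + 1)) (j := i') ℰp) (k + 1) U)
    rw [← h] at hs
    exact hs
  exact not_congr h'

/-- **WINDOW EVENTS OF THE NESTED LAWS ARE GIBBS EVENTS**: for laws with `ν K j = (descend j)_* ν K (j+1)` (`j < K`),
`ν K j (badAvg j k) = ν K K (badAvg K (k + (K − j)))`. [cite: Balaban1987RG1, (0.4)/(0.11) p.253] -/
theorem nestedLaw_badAvg_eq
    (ν : ℕ → (j : ℕ) → Measure (GaugeField (F.P j) 0 (Matrix.specialUnitaryGroup (Fin 2) ℂ)))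
    (h2 : ∀ K j, j < K → ν K j = Measure.map (descend F ℰp j) (ν K (j + 1)))
    (θ : ℝ) (K : ℕ) :
    ∀ d j k, j + d = K → ν K j (badAvg F θ j k) = ν K K (badAvg F θ K (k + d)) := by
  intro d
  induction d with
  | zero =>
    intro j k hj
    rw [add_zero] at hj
    subst hj
    rfl
  | succ d ih =>
    intro j k hj
    rw [h2 K j (by omega), Measure.map_apply (measurable_descend F ℰp measurableE_ℰp j) (measurableSet_badAvg F θ j k),
      preimage_descend_badAvg, ih (j + 1) (k + 1) (by omega)]
    congr 2
    omega

/-- The nested law at height `j ≤ K` gives «not `θ`-small» the `Gibbs_K`-mass of «the `(K−j)`-fold block average is not `θ`-small»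
(`ν K K = Gibbs_K`, `avg^0 = id`). [cite: Balaban1987RG1, (0.4)/(0.11) p.253] -/
theorem nestedLaw_not_plaqSmall_eq {γ : ℝ}
    (ν : ℕ → (j : ℕ) → Measure (GaugeField (F.P j) 0 (Matrix.specialUnitaryGroup (Fin 2) ℂ)))
    (h1 : ∀ K, ν K K = T4GenFunBounds.gibbsMeasure (F.P K) ((F.scheme ℰp γ).β K))
    (h2 : ∀ K j, j < K → ν K j = Measure.map (descend F ℰp j) (ν K (j + 1)))
    (θ : ℝ) {K j : ℕ} (hjK : j ≤ K) :
    ν K j {U | ¬ PlaqSmall θ U} =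
      gibbsK F ℰp γ K {U | ¬ PlaqSmall θ
        (Averaging.iter (fun i' => BlockAveraging.blockAvg (P := F.P K) (j := i') ℰp) (K - j) U)} := by
  have h := nestedLaw_badAvg_eq F ν h2 θ K (K - j) j 0 (by omega)
  rw [zero_add] at h
  simp only [badAvg] at h
  rw [h1 K] at h
  exact h

/-! ## §2 The explicit height profile and the per-run bound -/

/-- THE EXPLICIT HEIGHT PROFILE `f(h) = 9·(8L^{3m}(L^h)³) · (C·β_h^A·e^{−c·p(g_h)²})` — plaquette count of height `h` times a
large-field factor (the shape of the tree's `T3AveragedTailProfile.perHeight_bound`). [cite: Balaban1985UV3, (71) p.273] -/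
def profile (γ b₀ p₀ C : ℝ) (A : ℕ) (c : ℝ) (h : ℕ) : ℝ :=
  (9 * (8 * (F.L : ℝ) ^ (3 * F.m) * ((F.L : ℝ) ^ h) ^ 3)) *
    (C * (F.scheme ℰp γ).β h ^ A * Real.exp (-(c * B10.pFun b₀ p₀ (Real.sqrt (γ * ((F.L : ℝ)⁻¹) ^ h)) ^ 2)))

/-- The profile is nonnegative for `C ≥ 0`, `γ ≥ 0`. [folklore] -/
theorem profile_nonneg {γ b₀ p₀ C : ℝ} (hγ : 0 ≤ γ) (hC : 0 ≤ C) (A : ℕ) (c : ℝ) (h : ℕ) :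
    0 ≤ profile F γ b₀ p₀ C A c h := by
  unfold profile
  have := F.scheme_β_nonneg ℰp hγ h
  positivity

/-- **THE PER-RUN BOUND**: if the bare large-field events and the finest-bad-level events of one family at one coupling are bounded
by the profile (`Gibbs_K{¬PlaqSmall θ(K)} ≤ f(K)`, `Gibbs_K(finestBad(K, i)) ≤ f(K − i)` for `1 ≤ i ≤ K`), then for every run `K` and
every height `j ≤ K` the `Gibbs_K`-mass of «`Ū^{K−j}` is not `θ(j)`-small» is at most the TAIL `Σ'_k f(k + j)` — the least-bad-height
decomposition (`HistoryTailOfTwoSided.real_compl_histGood_le_sum_finestBad`), uniformly in `K`. [cite: Balaban1985UV3, (7) p.257 and (71) p.273] -/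
theorem real_badHeight_le_tsum {γ b₀ p₀ C : ℝ} (hγ : 0 ≤ γ) (hC : 0 ≤ C) {A : ℕ} {c : ℝ}
    (hs : Summable (profile F γ b₀ p₀ C A c))
    (hbare : ∀ K, (gibbsK F ℰp γ K).real {U | ¬ PlaqSmall (θBal F.L γ b₀ p₀ K) U} ≤ profile F γ b₀ p₀ C A c K)
    (hfb : ∀ K i, 1 ≤ i → i ≤ K → (gibbsK F ℰp γ K).real
      ({U | ¬ PlaqSmall (θBal F.L γ b₀ p₀ (K - i))
          (Averaging.iter (fun i' => BlockAveraging.blockAvg (P := F.P K) (j := i') ℰp) i U)} ∩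
        {U | ∀ i', i' < i → PlaqSmall (θBal F.L γ b₀ p₀ (K - i'))
          (Averaging.iter (fun i'' => BlockAveraging.blockAvg (P := F.P K) (j := i'') ℰp) i' U)}) ≤
      profile F γ b₀ p₀ C A c (K - i))
    {K j : ℕ} (hjK : j ≤ K) :
    (gibbsK F ℰp γ K).real {U | ¬ PlaqSmall (θBal F.L γ b₀ p₀ j)
        (Averaging.iter (fun i' => BlockAveraging.blockAvg (P := F.P K) (j := i') ℰp) (K - j) U)} ≤
      ∑' k, profile F γ b₀ p₀ C A c (k + j) := by
  classical
  haveI := isProbabilityMeasure_gibbsK F ℰp hγ K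
  -- the event lies outside the UV-small history with `j` free top steps
  have hsub : {U : GaugeField (F.P K) 0 (Matrix.specialUnitaryGroup (Fin 2) ℂ) | ¬ PlaqSmall (θBal F.L γ b₀ p₀ j)
        (Averaging.iter (fun i' => BlockAveraging.blockAvg (P := F.P K) (j := i') ℰp) (K - j) U)} ⊆
      (histGood F ℰp (θBal F.L γ b₀ p₀) K j)ᶜ := by
    intro U hU hgood
    apply hU
    have := hgood (K - j) (by omega)
    rwa [show K - (K - j) = j by omega] at this
  refine (measureReal_mono hsub (measure_ne_top _ _)).trans ?_
  refine (real_compl_histGood_le_sum_finestBad F ℰp (θBal F.L γ b₀ p₀) K j (gibbsK F ℰp γ K)).trans ?_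
  -- termwise: the bare level `i = 0`, the averaged levels `1 ≤ i ≤ K − j`
  have hterm : ∀ i ∈ Finset.range (K - j + 1), (gibbsK F ℰp γ K).real
      ({U | ¬ PlaqSmall (θBal F.L γ b₀ p₀ (K - i))
          (Averaging.iter (fun i' => BlockAveraging.blockAvg (P := F.P K) (j := i') ℰp) i U)} ∩
        {U | ∀ i', i' < i → PlaqSmall (θBal F.L γ b₀ p₀ (K - i'))
          (Averaging.iter (fun i'' => BlockAveraging.blockAvg (P := F.P K) (j := i'') ℰp) i' U)}) ≤
      profile F γ b₀ p₀ C A c (K - i) := by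
    intro i hi
    rcases Nat.eq_zero_or_pos i with h0 | hpos
    · subst h0
      refine le_trans (measureReal_mono (fun U hU => ?_) (measure_ne_top _ _)) (by simpa using hbare K)
      exact hU.1
    · exact hfb K i hpos (by simp only [Finset.mem_range] at hi; omega)
  refine (Finset.sum_le_sum hterm).trans ?_
  -- re-index `h = K − i = (K − j − i) + j` and compare with the tail of the series
  have hs' : Summable (fun k => profile F γ b₀ p₀ C A c (k + j)) := (summable_nat_add_iff j).mpr hs
  calc ∑ i ∈ Finset.range (K - j + 1), profile F γ b₀ p₀ C A c (K - i)
      = ∑ i ∈ Finset.range (K - j + 1), (fun k => profile F γ b₀ p₀ C A c (k + j)) (K - j + 1 - 1 - i) :=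
        Finset.sum_congr rfl fun i hi => by
          simp only [Finset.mem_range] at hi
          congr 1; omega
    _ = ∑ k ∈ Finset.range (K - j + 1), profile F γ b₀ p₀ C A c (k + j) :=
        Finset.sum_range_reflect (fun k => profile F γ b₀ p₀ C A c (k + j)) (K - j + 1)
    _ ≤ ∑' k, profile F γ b₀ p₀ C A c (k + j) :=
        hs'.sum_le_tsum _ fun k _ => profile_nonneg F hγ hC A c _


/-! ## §3 The profile dominates the bare level and the finest bad levels -/

/-- `L^h ≤ β_h` and `1 ≤ β_h` for `0 < γ ≤ 1`. [folklore] -/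
theorem pow_le_schemeβ {γ : ℝ} (hγ : 0 < γ) (hγ1 : γ ≤ 1) (h : ℕ) :
    (F.L : ℝ) ^ h ≤ (F.scheme ℰp γ).β h ∧ (1 : ℝ) ≤ (F.scheme ℰp γ).β h := by
  have hL1 : (1 : ℝ) ≤ F.L := by exact_mod_cast F.hL.2.le
  have hL0 : (0 : ℝ) < F.L := one_pos.trans_le hL1
  have hLh : (1 : ℝ) ≤ (F.L : ℝ) ^ h := one_le_pow₀ hL1
  have heq : (F.scheme ℰp γ).β h = (F.L : ℝ) ^ h / γ := by
    rw [show (F.scheme ℰp γ).β h = (γ * ((F.L : ℝ)⁻¹) ^ h)⁻¹ from rfl, inv_pow, mul_inv, inv_inv, div_eq_mul_inv, mul_comm]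
  rw [heq]
  have h1 : (F.L : ℝ) ^ h ≤ (F.L : ℝ) ^ h / γ := by
    rw [le_div_iff₀ hγ]
    exact mul_le_of_le_one_right (by positivity) hγ1
  exact ⟨h1, hLh.trans h1⟩

/-- THE BARE LEVEL IS BELOW THE PROFILE: with the tree's finest-height bound (`T3FinestHeightTail.gibbsK_real_not_plaqSmall_le`, constant
`cb`), `Gibbs_K{¬PlaqSmall θ(K)} ≤ f(K)` as soon as `C ≥ 2e^{24}cb⁻³`, `A ≥ 5`, `c ≤ 1/4` (`0 < γ ≤ 1`, `b₀ ≥ 0`). [cite: Balaban1985UV3, (71) p.273] -/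
theorem bare_le_profile {γ b₀ p₀ C c cb : ℝ} {A : ℕ} (hγ : 0 < γ) (hγ1 : γ ≤ 1) (hb₀ : 0 ≤ b₀)
    (Hb : ∀ (K : ℕ), 1 ≤ (F.scheme ℰp γ).β K → 0 ≤ B10.pFun b₀ p₀ (Real.sqrt (γ * ((F.L : ℝ)⁻¹) ^ K)) →
      (gibbsK F ℰp γ K).real {U | ¬ PlaqSmall (θBal F.L γ b₀ p₀ K) U} ≤
        Fintype.card (Plaq (F.P K) 0) *
          (2 * Real.exp 24 * (cb ^ 3)⁻¹ * Real.sqrt ((F.scheme ℰp γ).β K) ^ 9 *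
            Real.exp (-(B10.pFun b₀ p₀ (Real.sqrt (γ * ((F.L : ℝ)⁻¹) ^ K)) ^ 2 / 4))))
    (hcb : 0 < cb) (hC : 2 * Real.exp 24 * (cb ^ 3)⁻¹ ≤ C) (hA : 5 ≤ A) (hc : c ≤ 1 / 4) (K : ℕ) :
    (gibbsK F ℰp γ K).real {U | ¬ PlaqSmall (θBal F.L γ b₀ p₀ K) U} ≤ profile F γ b₀ p₀ C A c K := by
  obtain ⟨-, hβ1⟩ := pow_le_schemeβ F hγ hγ1 K
  have hL1 : (1 : ℝ) ≤ F.L := by exact_mod_cast F.hL.2.le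
  have hL0 : (0 : ℝ) < F.L := one_pos.trans_le hL1
  have hg : 0 < Real.sqrt (γ * ((F.L : ℝ)⁻¹) ^ K) := Real.sqrt_pos.mpr (by positivity)
  have hg1 : Real.sqrt (γ * ((F.L : ℝ)⁻¹) ^ K) ≤ 1 := by
    rw [Real.sqrt_le_one]
    have : ((F.L : ℝ)⁻¹) ^ K ≤ 1 := pow_le_one₀ (inv_nonneg.mpr hL0.le) (inv_le_one_of_one_le₀ hL1)
    nlinarith
  have hp : 0 ≤ B10.pFun b₀ p₀ (Real.sqrt (γ * ((F.L : ℝ)⁻¹) ^ K)) := B10.pFun_nonneg b₀ p₀ _ hb₀ hg hg1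
  refine (Hb K hβ1 hp).trans ?_
  unfold profile
  have hcard := card_plaq_le_pow F (le_refl K)
  rw [Nat.sub_self, pow_zero] at hcard
  -- hcard : card ≤ 9 * (8 * L^{3m} * 1 ^ 3)  — we need the `(L^K)^3` form; redo with `j = 0`
  have hcard' : (Fintype.card (Plaq (F.P K) 0) : ℝ) ≤ 9 * (8 * (F.L : ℝ) ^ (3 * F.m) * ((F.L : ℝ) ^ K) ^ 3) := by
    have h0 := card_plaq_le_pow F (Nat.zero_le K)
    simpa using h0
  set β := (F.scheme ℰp γ).β K with hβdef
  set pg := B10.pFun b₀ p₀ (Real.sqrt (γ * ((F.L : ℝ)⁻¹) ^ K)) with hpg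
  -- the large-field factor
  have hsqrt : Real.sqrt β ^ 9 ≤ β ^ A := by
    have hs1 : 1 ≤ Real.sqrt β := Real.one_le_sqrt.mpr hβ1
    have hsβ : Real.sqrt β ≤ β := by
      calc Real.sqrt β = Real.sqrt β * 1 := (mul_one _).symm
        _ ≤ Real.sqrt β * Real.sqrt β := mul_le_mul_of_nonneg_left hs1 (by positivity)
        _ = β := Real.mul_self_sqrt (by linarith)
    calc Real.sqrt β ^ 9 = Real.sqrt β ^ 8 * Real.sqrt β := by ring
      _ = β ^ 4 * Real.sqrt β := by
          rw [show (8 : ℕ) = 2 * 4 by norm_num, pow_mul, Real.sq_sqrt (by linarith)]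
      _ ≤ β ^ 4 * β := mul_le_mul_of_nonneg_left hsβ (by positivity)
      _ = β ^ 5 := by ring
      _ ≤ β ^ A := pow_le_pow_right₀ hβ1 hA
  have hexp : Real.exp (-(pg ^ 2 / 4)) ≤ Real.exp (-(c * pg ^ 2)) := by
    apply Real.exp_le_exp.mpr
    have : 0 ≤ pg ^ 2 := sq_nonneg _
    nlinarith
  have hfac : 2 * Real.exp 24 * (cb ^ 3)⁻¹ * Real.sqrt β ^ 9 * Real.exp (-(pg ^ 2 / 4)) ≤
      C * β ^ A * Real.exp (-(c * pg ^ 2)) := by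
    have h0 : 0 ≤ 2 * Real.exp 24 * (cb ^ 3)⁻¹ := by positivity
    have h1 : 0 ≤ C := h0.trans hC
    exact mul_le_mul (mul_le_mul hC hsqrt (by positivity) h1) hexp (by positivity) (by positivity)
  have hfac0 : 0 ≤ 2 * Real.exp 24 * (cb ^ 3)⁻¹ * Real.sqrt β ^ 9 * Real.exp (-(pg ^ 2 / 4)) := by positivity
  exact mul_le_mul hcard' hfac hfac0 (by positivity)

/-- THE FINEST BAD LEVELS ARE BELOW THE PROFILE: under the window (level `i−1` small ⇒ level `i` in the `b₂`-window) and the first-exit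
tail `Gibbs_K(FE(K, i, p)) ≤ C₀·β_{K−i}^N·e^{−c₀ p²}`, `Gibbs_K(finestBad(K, i)) ≤ f(K − i)` as soon as `C ≥ max C₀ 0`, `A ≥ N`, `c ≤ c₀`
(`LargeFieldMassRefinementTailOfFirstExit.real_finestBad_le_card_mul` + `card_plaq_le_pow`). [cite: Balaban1985UV3, (7) p.257 and (71) p.273] -/
theorem finestBad_le_profile {γ b₀ b₂ p₀ C₀ c₀ C c : ℝ} {N A : ℕ} (hγ : 0 < γ) (hγ1 : γ ≤ 1)
    (hW : ∀ K j : ℕ, j + 1 ≤ K → ∀ U : GaugeField (F.P K) 0 (Matrix.specialUnitaryGroup (Fin 2) ℂ),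
      PlaqSmall (θBal F.L γ b₀ p₀ (K - j))
          (Averaging.iter (fun i => BlockAveraging.blockAvg (P := F.P K) (j := i) ℰp) j U) →
        PlaqSmall (θBal F.L γ b₂ p₀ (K - (j + 1)))
          (Averaging.iter (fun i => BlockAveraging.blockAvg (P := F.P K) (j := i) ℰp) (j + 1) U))
    (hFE : ∀ K j : ℕ, 1 ≤ j → j ≤ K → ∀ p : Plaq (F.P K) j, (gibbsK F ℰp γ K).real
      {U | (∀ k, k < j → PlaqSmall (θBal F.L γ b₀ p₀ (K - k))
          (Averaging.iter (fun i => BlockAveraging.blockAvg (P := F.P K) (j := i) ℰp) k U)) ∧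
        PlaqSmall (θBal F.L γ b₂ p₀ (K - j))
          (Averaging.iter (fun i => BlockAveraging.blockAvg (P := F.P K) (j := i) ℰp) j U) ∧
        θBal F.L γ b₀ p₀ (K - j) ≤ GaugeGroup.dist1 (GaugeField.plaqHol
          (Averaging.iter (fun i => BlockAveraging.blockAvg (P := F.P K) (j := i) ℰp) j U) p)} ≤
      C₀ * ((γ * ((F.L : ℝ)⁻¹) ^ (K - j))⁻¹) ^ N *
        Real.exp (-(c₀ * B10.pFun b₀ p₀ (Real.sqrt (γ * ((F.L : ℝ)⁻¹) ^ (K - j))) ^ 2)))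
    (hC : max C₀ 0 ≤ C) (hA : N ≤ A) (hc : c ≤ c₀)
    (K i : ℕ) (hi : 1 ≤ i) (hiK : i ≤ K) :
    (gibbsK F ℰp γ K).real
      ({U | ¬ PlaqSmall (θBal F.L γ b₀ p₀ (K - i))
          (Averaging.iter (fun i' => BlockAveraging.blockAvg (P := F.P K) (j := i') ℰp) i U)} ∩
        {U | ∀ i', i' < i → PlaqSmall (θBal F.L γ b₀ p₀ (K - i'))
          (Averaging.iter (fun i'' => BlockAveraging.blockAvg (P := F.P K) (j := i'') ℰp) i' U)}) ≤
      profile F γ b₀ p₀ C A c (K - i) := by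
  obtain ⟨i, rfl⟩ : ∃ i', i = i' + 1 := ⟨i - 1, by omega⟩
  haveI := isProbabilityMeasure_gibbsK F ℰp hγ.le K
  set β := (F.scheme ℰp γ).β (K - (i + 1)) with hβdef
  set pg := B10.pFun b₀ p₀ (Real.sqrt (γ * ((F.L : ℝ)⁻¹) ^ (K - (i + 1)))) with hpg
  obtain ⟨-, hβ1⟩ := pow_le_schemeβ F hγ hγ1 (K - (i + 1))
  have hB : ∀ p : Plaq (F.P K) (i + 1), (gibbsK F ℰp γ K).real
      {U | (∀ k, k < i + 1 → PlaqSmall (θBal F.L γ b₀ p₀ (K - k))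
          (Averaging.iter (fun i => BlockAveraging.blockAvg (P := F.P K) (j := i) ℰp) k U)) ∧
        PlaqSmall (θBal F.L γ b₂ p₀ (K - (i + 1)))
          (Averaging.iter (fun i => BlockAveraging.blockAvg (P := F.P K) (j := i) ℰp) (i + 1) U) ∧
        θBal F.L γ b₀ p₀ (K - (i + 1)) ≤ GaugeGroup.dist1 (GaugeField.plaqHol
          (Averaging.iter (fun i => BlockAveraging.blockAvg (P := F.P K) (j := i) ℰp) (i + 1) U) p)} ≤
      C * β ^ A * Real.exp (-(c * pg ^ 2)) := by
    intro p
    refine (hFE K (i + 1) hi hiK p).trans ?_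
    show C₀ * β ^ N * Real.exp (-(c₀ * pg ^ 2)) ≤ C * β ^ A * Real.exp (-(c * pg ^ 2))
    have hC₀ : C₀ ≤ C := (le_max_left _ _).trans hC
    have hC0 : 0 ≤ C := (le_max_right _ _).trans hC
    have hpow : β ^ N ≤ β ^ A := pow_le_pow_right₀ hβ1 hA
    have hexp : Real.exp (-(c₀ * pg ^ 2)) ≤ Real.exp (-(c * pg ^ 2)) := by
      apply Real.exp_le_exp.mpr
      have : 0 ≤ pg ^ 2 := sq_nonneg _
      nlinarith
    calc C₀ * β ^ N * Real.exp (-(c₀ * pg ^ 2)) ≤ C * β ^ N * Real.exp (-(c₀ * pg ^ 2)) := by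
          gcongr
      _ ≤ C * β ^ A * Real.exp (-(c * pg ^ 2)) :=
          mul_le_mul (mul_le_mul_of_nonneg_left hpow hC0) hexp (by positivity) (by positivity)
  refine (real_finestBad_le_card_mul F γ b₀ b₂ p₀ (gibbsK F ℰp γ K) (hW K i hiK) hB).trans ?_
  unfold profile
  have hE0 : 0 ≤ C * β ^ A * Real.exp (-(c * pg ^ 2)) :=
    mul_nonneg (mul_nonneg ((le_max_right _ _).trans hC) (pow_nonneg (by linarith) A)) (Real.exp_nonneg _)
  exact mul_le_mul_of_nonneg_right (card_plaq_le_pow F hiK) hE0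

/-! ## §4 The floor-class weights and the geometric majorant -/

/-- THE FLOOR-CLASS WEIGHT of the run-pair organ at height `h`: `(1 + 2β_h·#Plaq_h)·#PBond_h²` (finest-lattice counts of the `h`-th
approximation). [cite: Balaban1985UV3, (1)-(3) p.256] -/
def weight (γ : ℝ) (h : ℕ) : ℝ :=
  (1 + 2 * ((F.L : ℝ) ^ h / γ) * (Fintype.card (Plaq (F.P h) 0) : ℝ)) * (Fintype.card (PBond (F.P h) 0) : ℝ) ^ 2

/-- The weight is nonnegative (`γ ≥ 0`). [folklore] -/
theorem weight_nonneg {γ : ℝ} (hγ : 0 ≤ γ) (h : ℕ) : 0 ≤ weight F γ h := by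
  unfold weight; positivity

/-- `#PBond` of the finest lattice of the `h`-th approximation is `≤ 9·(8L^{3m}(L^h)³)` (`= 3·(2L^{m+h})³` exactly). [cite: Balaban1985Averaging, (5) p.18] -/
theorem card_pbond_le_pow (h : ℕ) :
    (Fintype.card (PBond (F.P h) 0) : ℝ) ≤ 9 * (8 * (F.L : ℝ) ^ (3 * F.m) * ((F.L : ℝ) ^ h) ^ 3) := by
  have hcard : Fintype.card (PBond (F.P h) 0) = (F.P h).d * Fintype.card (Site (F.P h) 0) := by
    rw [Fintype.ofEquiv_card, Fintype.card_prod, Fintype.card_fin, mul_comm]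
  have hsite : Fintype.card (Site (F.P h) 0) = (2 * F.L ^ (F.m + h)) ^ 3 := by
    rw [Site.card_site]
    show (2 * F.L ^ (F.m + h - 0)) ^ 3 = _
    rw [Nat.sub_zero]
  rw [hcard, hsite, T3Family.P_d]
  push_cast
  have hL1 : (1 : ℝ) ≤ F.L := by exact_mod_cast F.hL.2.le
  have h0 : (0 : ℝ) ≤ (F.L : ℝ) ^ (3 * F.m) * ((F.L : ℝ) ^ h) ^ 3 := by positivity
  have : (3 : ℝ) * (2 * (F.L : ℝ) ^ (F.m + h)) ^ 3 = 24 * ((F.L : ℝ) ^ (3 * F.m) * ((F.L : ℝ) ^ h) ^ 3) := by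
    rw [pow_add]; ring
  rw [this]
  nlinarith

/-- THE WEIGHT IS POLYNOMIAL IN `β_h`: `weight h ≤ 145·72²·L^{9m}·β_h^{10}` (`0 < γ ≤ 1`). [folklore] -/
theorem weight_le {γ : ℝ} (hγ : 0 < γ) (hγ1 : γ ≤ 1) (h : ℕ) :
    weight F γ h ≤ (145 * 72 ^ 2 * (F.L : ℝ) ^ (9 * F.m)) * (F.scheme ℰp γ).β h ^ 10 := by
  obtain ⟨hLβ, hβ1⟩ := pow_le_schemeβ F hγ hγ1 h
  set β := (F.scheme ℰp γ).β h with hβdef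
  have hL1 : (1 : ℝ) ≤ F.L := by exact_mod_cast F.hL.2.le
  have hLm : (1 : ℝ) ≤ (F.L : ℝ) ^ (3 * F.m) := one_le_pow₀ hL1
  set Lm : ℝ := (F.L : ℝ) ^ (3 * F.m) with hLm'
  have hP := card_plaq_le_pow F (Nat.zero_le h)
  simp only [Nat.sub_zero] at hP
  have hB := card_pbond_le_pow F h
  have hβdiv : (F.L : ℝ) ^ h / γ = β := by
    rw [hβdef, show (F.scheme ℰp γ).β h = (γ * ((F.L : ℝ)⁻¹) ^ h)⁻¹ from rfl, inv_pow, mul_inv, inv_inv,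
      div_eq_mul_inv, mul_comm]
  have hL3 : ((F.L : ℝ) ^ h) ^ 3 ≤ β ^ 3 := pow_le_pow_left₀ (by positivity) hLβ 3
  set Q : ℝ := 72 * Lm * β ^ 3 with hQ
  have hPQ : (Fintype.card (Plaq (F.P h) 0) : ℝ) ≤ Q := by
    calc (Fintype.card (Plaq (F.P h) 0) : ℝ) ≤ 9 * (8 * Lm * ((F.L : ℝ) ^ h) ^ 3) := hP
      _ ≤ 9 * (8 * Lm * β ^ 3) := by gcongr
      _ = Q := by rw [hQ]; ring
  have hBQ : (Fintype.card (PBond (F.P h) 0) : ℝ) ≤ Q := by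
    calc (Fintype.card (PBond (F.P h) 0) : ℝ) ≤ 9 * (8 * Lm * ((F.L : ℝ) ^ h) ^ 3) := hB
      _ ≤ 9 * (8 * Lm * β ^ 3) := by gcongr
      _ = Q := by rw [hQ]; ring
  have hQ0 : 0 ≤ Q := by positivity
  unfold weight
  rw [hβdiv]
  have h1 : 1 + 2 * β * (Fintype.card (Plaq (F.P h) 0) : ℝ) ≤ 145 * Lm * β ^ 4 := by
    have : 2 * β * (Fintype.card (Plaq (F.P h) 0) : ℝ) ≤ 2 * β * Q := by gcongr
    have hone : (1 : ℝ) ≤ Lm * β ^ 4 := by nlinarith [one_le_pow₀ (M₀ := ℝ) hβ1 (n := 4)]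
    nlinarith
  have h2 : (Fintype.card (PBond (F.P h) 0) : ℝ) ^ 2 ≤ Q ^ 2 := pow_le_pow_left₀ (by positivity) hBQ 2
  calc (1 + 2 * β * (Fintype.card (Plaq (F.P h) 0) : ℝ)) * (Fintype.card (PBond (F.P h) 0) : ℝ) ^ 2
      ≤ (145 * Lm * β ^ 4) * Q ^ 2 := mul_le_mul h1 h2 (by positivity) (by positivity)
    _ = (145 * 72 ^ 2 * (Lm * Lm ^ 2)) * β ^ 10 := by rw [hQ]; ring
    _ = (145 * 72 ^ 2 * (F.L : ℝ) ^ (9 * F.m)) * β ^ 10 := by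
        rw [hLm']; ring

/-- THE GEOMETRIC MAJORANT of the weighted profile: `Cw·β_h^{10}·f(h) = f_{Cw·C, A+10}(h) ≤ M·2^{−h}` for ALL `h`
(`T3AveragedTailProfile.perHeight_bound`; `0 < γ ≤ 1`, `0 < b₀`, `1 ≤ p₀`, `0 ≤ C`, `0 < c`). [cite: Balaban1985UV3, (71) p.273] -/
theorem weighted_profile_le {γ b₀ p₀ C c Cw : ℝ} {A : ℕ} (hγ : 0 < γ) (hγ1 : γ ≤ 1) (hb₀ : 0 < b₀) (hp₀ : 1 ≤ p₀)
    (hC : 0 ≤ C) (hc : 0 < c) (hCw : 0 ≤ Cw) :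
    ∃ M : ℝ, 0 ≤ M ∧ ∀ h : ℕ, (Cw * (F.scheme ℰp γ).β h ^ 10) * profile F γ b₀ p₀ C A c h ≤ M * ((1 : ℝ) / 2) ^ h := by
  refine ⟨72 * (Cw * C) * (F.L : ℝ) ^ (3 * F.m) * γ⁻¹ ^ (A + 10) *
      Real.exp ((((3 : ℝ) + (A + 10 : ℕ)) * Real.log F.L + Real.log 2) ^ 2 / (4 * (c * b₀ ^ 2 * Real.log F.L ^ 2 / 4))),
    by positivity, fun h => ?_⟩
  have hph := T3AveragedTailProfile.perHeight_bound F hγ hγ1 hb₀ hp₀ (mul_nonneg hCw hC) (A + 10) hc h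
  have heq : (Cw * (F.scheme ℰp γ).β h ^ 10) * profile F γ b₀ p₀ C A c h =
      (9 * (8 * (F.L : ℝ) ^ (3 * F.m) * ((F.L : ℝ) ^ h) ^ 3)) *
        (Cw * C * (F.scheme ℰp γ).β h ^ (A + 10) *
          Real.exp (-(c * B10.pFun b₀ p₀ (Real.sqrt (γ * ((F.L : ℝ)⁻¹) ^ h)) ^ 2))) := by
    unfold profile; ring
  rw [heq]
  exact hph


end Summit.QuantumFields.YangMills.Theorems.FluctuationComparisonRegPrIntL.RunPairOrgan.RunWindowTailsDoor
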